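import Summits.Schanuel.Schanuel.Theorems.ZilberEacParamRamifiedWitness
import Summits.Schanuel.Schanuel.Theorems.ZilberEacParamRamifiedTrichotomy
import Summits.Schanuel.Schanuel.Theorems.ZilberEacRamifiedBranchAlgebraic
import HarnessLib

/-!
# Polynomially parametrised base curves, LXXVII: non-density over a polynomial curve makes the
# logarithm of a ramified branch ALGEBRAIC over `ℂ(t)`

HONEST FRAMING.  Cell `pub-schanuel` (Zilber's Exponential-Algebraic Closedness, case ladder;
host summit Schanuel), seat 2, gen 27.  The analogue over a polynomially parametrised base curve
`(x₀, x₁) = (g₀(t), g₁(t))` with `1 ≤ deg g₀ < deg g₁` of file LXII (graphs `x₁ = p(x₀)`,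
`deg p ≥ 2`).
* **`isAlgebraic_log_of_paramExp_relation_ramified`** — the algebraic core of file LXI with the
  chart `C·R^K = g₀(z) - L(z) - τ` in place of `C·R^k = z - L - τ`: applied to
  `L̃ = L - g₀ + z` (so that `L̃' = L' - g₀' + 1` is algebraic iff `L'` is), it needs
  `L'(z₀) ≠ g₀'(z₀)` and `deg Π ≥ K + 1`.
* **`exists_algebraic_log_of_not_dense_ramified_param`** — if the fibre-curve surface
  `S = {(g₀(t), g₁(t), y₀, y₁) : P(t, y₀) = 0}` (`P` irreducible of positive `y₀`-degree) has a
  cycle of branches at infinity `t = s^{-k}`, `y₀ = ψ(s) → θ ≠ 0` and is NOT dense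
  (`I(S ∩ Γ_exp) ≠ I(S)`), then at some (large real) `t₀` the branch `ρ(t) = ψ(t^{-1/k})` of
  `Q(t, ·) = 0` has a logarithm `L = log(ρ/θ)` whose germ is ALGEBRAIC over `ℂ[zGerm t₀]`.  Chain:
  chart (LXXIV) ⟶ witness with `kd`-th-power labels (LXXV) ⟶ trichotomy (LXXVI) leaves a relation
  `H(U₀(μ)μ^{-kd}, e^{r(μ)}) = 0` ⟶ transported to `t` near `t₀`:
  `H(g₀(t), exp(g₁(t) - Π(R(t)))) = 0`, `2πi R^{kd} = g₀(t) - L(t) - τ` ⟶ the algebraic core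
  (`deg Π = k·deg g₁ ≥ kd + 1` exactly when `deg g₀ < deg g₁`; `|L'(t₀)| < c ≤ |g₀'(t₀)|` for `t₀`
  large; `ρ'/ρ` algebraic by irreducibility, file LXI).
Gen 25's transcendence theorems (file XLVIII) refute the conclusion along any parametrised zero or
pole branch of the fibre curve: that is the master theorem of file LXXVIII.  Complete classes of
instances of an OPEN question (Mantova–Masser, PLMS 2024 §1 p. 5); EC(3,2) OPEN; NOT Schanuel's
conjecture (neither used nor implied); EAC ⇏ SC.
-/

noncomputable section

open Filter Topology Polynomial Complex
open Literature.NumberTheory.Transcendental Literature.ModelTheory.Zilber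
open Literature.ModelTheory.ExponentialFields

set_option linter.dupNamespace false

namespace Summit.Schanuel.Schanuel.Theorems

/-! ## Part A. Two small tools -/

/-- A nonzero polynomial is bounded below by a positive constant on every far real half-line.
[folklore] -/
theorem exists_pos_le_norm_eval (f : ℂ[X]) (hf : f ≠ 0) :
    ∃ c R₁ : ℝ, 0 < c ∧ ∀ x : ℝ, R₁ ≤ x → c ≤ ‖f.eval (x : ℂ)‖ := by
  by_cases hdeg : 0 < f.degree
  · have hz : Tendsto (fun x : ℝ => ‖((x : ℝ) : ℂ)‖) atTop atTop := by
      refine tendsto_norm_atTop_atTop.congr fun x => ?_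
      rw [Complex.norm_real]
    obtain ⟨R₁, hR₁⟩ := Filter.eventually_atTop.1
      ((f.tendsto_norm_atTop hdeg hz).eventually (eventually_ge_atTop 1))
    exact ⟨1, R₁, one_pos, hR₁⟩
  · have h0 : f = Polynomial.C (f.coeff 0) := Polynomial.eq_C_of_degree_le_zero (le_of_not_gt hdeg)
    have hc0 : f.coeff 0 ≠ 0 := fun h => hf (by rw [h0, h, map_zero])
    refine ⟨‖f.coeff 0‖, 0, norm_pos_iff.2 hc0, fun x _ => ?_⟩
    rw [h0, Polynomial.eval_C, Polynomial.coeff_C_zero]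

/-- Composition with `g₀` inside the `s`-coefficients: `H ↦ H(g₀(s), t)`; evaluation at `s = z` of
the composite is evaluation of `H` at `s = g₀(z)`. [folklore] -/
theorem map_evalRingHom_map_compRingHom (H : ℂ[X][X]) (g₀ : ℂ[X]) (z : ℂ) :
    (H.map (Polynomial.compRingHom g₀)).map (Polynomial.evalRingHom z) =
      H.map (Polynomial.evalRingHom (g₀.eval z)) := by
  rw [Polynomial.map_map]
  congr 1
  ext p
  · simp
  · simp

/-- `H ↦ H(g₀(s), t)` is injective for non-constant `g₀`. [folklore] -/
theorem map_compRingHom_ne_zero {H : ℂ[X][X]} (hH : H ≠ 0) {g₀ : ℂ[X]} (hd : 1 ≤ g₀.natDegree) :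
    H.map (Polynomial.compRingHom g₀) ≠ 0 := by
  have hinj : Function.Injective (Polynomial.compRingHom g₀ : ℂ[X] → ℂ[X]) := by
    refine (injective_iff_map_eq_zero _).2 fun p hp => ?_
    rw [Polynomial.coe_compRingHom_apply, Polynomial.comp_eq_zero_iff] at hp
    rcases hp with hp | ⟨-, hq⟩
    · exact hp
    · exfalso
      have h := congrArg Polynomial.natDegree hq
      rw [Polynomial.natDegree_C] at h
      omega
  exact fun h => hH (Polynomial.map_injective _ hinj (by rw [h, Polynomial.map_zero]))

/-! ## Part B. The algebraic core with the chart `C R^K = g₀(z) - L - τ` -/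

/-- **The algebraic conclusion along a ramified cycle over a polynomial curve.**  `L' = g`
algebraic over `ℂ[zGerm]` with `g(z₀) ≠ g₀'(z₀)`, `C·R^K = g₀(z) - L(z) - τ` near `z₀` (`K ≥ 1`),
`deg Π ≥ K + 1`, and a relation `H(z, exp(g₁(z) - Π(R z))) = 0` near `z₀` with `H ≠ 0` ⟹ the germ
of `L` is algebraic over `ℂ[zGerm]`.  (File LXI applied to `L̃ = L - g₀ + z`.)
[folklore differential algebra] (new in this form) -/
theorem isAlgebraic_log_of_paramExp_relation_ramified {z₀ : ℂ} {L g R : ℂ → ℂ}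
    (hLan : AnalyticAt ℂ L z₀) (hgan : AnalyticAt ℂ g z₀) (hL : ∀ᶠ z in 𝓝 z₀, HasDerivAt L (g z) z)
    (hgalg : IsAlgebraic (Algebra.adjoin ℂ ({zGerm z₀} : Set (AGerm z₀))) (AGerm.mk z₀ hgan))
    (g₀ : ℂ[X]) (hg1 : g z₀ ≠ (derivative g₀).eval z₀) (hRan : AnalyticAt ℂ R z₀) {C τ : ℂ} {K : ℕ}
    (hK : 1 ≤ K) (hR : ∀ᶠ z in 𝓝 z₀, C * R z ^ K = g₀.eval z - L z - τ)
    (g₁ Pt : ℂ[X]) (hPt : K + 1 ≤ Pt.natDegree) {H : ℂ[X][X]} (hH0 : H ≠ 0)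
    (hH : ∀ᶠ z in 𝓝 z₀, (H.map (Polynomial.evalRingHom z)).eval
      (Complex.exp (g₁.eval z - Pt.eval (R z))) = 0) :
    IsAlgebraic (Algebra.adjoin ℂ ({zGerm z₀} : Set (AGerm z₀))) (AGerm.mk z₀ hLan) := by
  -- `L̃ = L - g₀ + z`, `g̃ = g - g₀' + 1`
  have hg₀an : AnalyticAt ℂ (fun z => g₀.eval z) z₀ := analyticAt_polynomial_eval g₀ z₀
  have hg₀'an : AnalyticAt ℂ (fun z => (derivative g₀).eval z) z₀ :=
    analyticAt_polynomial_eval (derivative g₀) z₀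
  have hLtan : AnalyticAt ℂ (fun z => L z - g₀.eval z + z) z₀ := (hLan.sub hg₀an).add analyticAt_id
  have hgtan : AnalyticAt ℂ (fun z => g z - (derivative g₀).eval z + 1) z₀ :=
    (hgan.sub hg₀'an).add analyticAt_const
  have hLt : ∀ᶠ z in 𝓝 z₀, HasDerivAt (fun z => L z - g₀.eval z + z)
      (g z - (derivative g₀).eval z + 1) z := by
    filter_upwards [hL] with z hLz
    exact (hLz.sub (Polynomial.hasDerivAt g₀ z)).add (hasDerivAt_id z)
  have hgtalg : IsAlgebraic (Algebra.adjoin ℂ ({zGerm z₀} : Set (AGerm z₀))) (AGerm.mk z₀ hgtan) := by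
    have e : AGerm.mk z₀ hgtan = AGerm.mk z₀ hgan - Polynomial.aeval (zGerm z₀) (derivative g₀) + 1 := by
      rw [aeval_zGerm, ← AGerm.mk_sub, ← AGerm.mk_one, ← AGerm.mk_add]
    rw [e]
    exact (hgalg.sub (isAlgebraic_aeval_zGerm z₀ _)).add isAlgebraic_one
  have hgt1 : g z₀ - (derivative g₀).eval z₀ + 1 ≠ 1 := by
    intro h
    exact hg1 (by linear_combination h)
  have hRt : ∀ᶠ z in 𝓝 z₀, C * R z ^ K = z - (L z - g₀.eval z + z) - τ := by
    filter_upwards [hR] with z hz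
    linear_combination hz
  have halg := isAlgebraic_log_of_graphExp_relation_ramified hLtan hgtan hLt hgtalg hgt1 hRan hK hRt
    g₁ Pt hPt hH0 hH
  -- `L = L̃ + g₀ - z`
  have e : AGerm.mk z₀ hLan = AGerm.mk z₀ hLtan + Polynomial.aeval (zGerm z₀) g₀ - zGerm z₀ := by
    rw [aeval_zGerm, zGerm, ← AGerm.mk_add, ← AGerm.mk_sub]
    exact AGerm.mk_congr _ _ fun z => by simp only [Pi.add_apply, Pi.sub_apply, id_eq]; ring
  rw [e]
  refine (halg.add (isAlgebraic_aeval_zGerm z₀ _)).sub ?_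
  have h := isAlgebraic_aeval_zGerm z₀ Polynomial.X
  rwa [Polynomial.aeval_X] at h

/-! ## Part C. Non-density over a polynomial curve makes the logarithm of a branch algebraic -/

/-- **Non-density over a polynomial curve makes the logarithm of a ramified branch algebraic.**
See the module docstring. [cite: MantovaMasser2023, §1 Further remarks, p. 5 (the question, open in
general)] (new) -/
theorem exists_algebraic_log_of_not_dense_ramified_param (g₀ g₁ : ℂ[X]) (hd : 1 ≤ g₀.natDegree)
    (hlt : g₀.natDegree < g₁.natDegree) (Q : ℂ[X][X]) {P : MvPolynomial (Fin 2) ℂ}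
    (hP : ∀ x y : ℂ, MvPolynomial.eval ![x, y] P = (Q.map (Polynomial.evalRingHom x)).eval y)
    (hirr : Irreducible P) (hQ1 : Q.natDegree ≠ 0) {k : ℕ} (hk : 1 ≤ k)
    {ψ : ℂ → ℂ} (hψ : AnalyticAt ℂ ψ 0) {θ : ℂ} (hθ0 : θ ≠ 0) (hψ0 : ψ 0 = θ)
    (hbranch : ∀ᶠ s in 𝓝[≠] (0 : ℂ), (Q.map (Polynomial.evalRingHom (s ^ k)⁻¹)).eval (ψ s) = 0)
    (hnot : ¬ UnprojectedDense {w : Fin 2 ⊕ Fin 2 → ℂ | ∃ t : ℂ, w (Sum.inl 0) = g₀.eval t ∧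
      w (Sum.inl 1) = g₁.eval t ∧ MvPolynomial.eval ![t, w (Sum.inr 0)] P = 0}) :
    ∃ (z₀ : ℂ) (ρ L : ℂ → ℂ) (hLan : AnalyticAt ℂ L z₀), AnalyticAt ℂ ρ z₀ ∧
      ρ z₀ ≠ 0 ∧ (∀ᶠ z in 𝓝 z₀, (Q.map (Polynomial.evalRingHom z)).eval (ρ z) = 0) ∧
      (∀ᶠ z in 𝓝 z₀, HasDerivAt L (deriv ρ z / ρ z) z) ∧
      IsAlgebraic (Algebra.adjoin ℂ ({zGerm z₀} : Set (AGerm z₀))) (AGerm.mk z₀ hLan) := by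
  classical
  have hQirr : Irreducible Q := (irreducible_rows_iff hP).1 hirr
  set d := g₀.natDegree with hdd
  set K := k * d with hKdef
  have hk0 : k ≠ 0 := by omega
  have hK : 1 ≤ K := Nat.one_le_iff_ne_zero.2 (Nat.mul_ne_zero hk0 (by omega))
  have hkC : (k : ℂ) ≠ 0 := Nat.cast_ne_zero.2 hk0
  -- `θ = e^τ`
  set τ : ℂ := Complex.log θ with hτdef
  have hτ : Complex.exp τ = θ := Complex.exp_log hθ0
  -- chart, witness, and the relation left by non-density
  obtain ⟨m, hman, hm0, hm', hchart⟩ := exists_ramifiedChart_param g₀ hd hψ hθ0 hψ0 τ hk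
  obtain ⟨U₀, r, Pl, m₀, μ, t, hUan, -, hran, hPl, hside, hμ0, hμ, hx, hteq, hnorm, -, hid₁⟩ :=
    exists_ramified_witness_param Q g₀ g₁ hd hθ0 hτ hk hbranch hman hm0 hm' hchart
  have hrel : ∃ H : ℂ[X][X], H ≠ 0 ∧
      ∀ᶠ u in 𝓝[≠] (0 : ℂ), (H.map (Polynomial.evalRingHom (U₀ u * u⁻¹ ^ K))).eval
        (Complex.exp (r u)) = 0 := by
    by_contra htr'
    have htr : ∀ H : ℂ[X][X], H ≠ 0 →
        ¬ (∀ᶠ u in 𝓝[≠] (0 : ℂ), (H.map (Polynomial.evalRingHom (U₀ u * u⁻¹ ^ K))).eval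
          (Complex.exp (r u)) = 0) :=
      fun H hH0 hH => htr' ⟨H, hH0, hH⟩
    exact hnot (unprojectedDense_of_ramified_witness_param g₀ g₁ hd Q hP hirr Pl hUan hran htr m₀ hμ0
      hμ hx hteq hnorm hid₁)
  obtain ⟨H, hH0, hH⟩ := hrel
  -- the lower bound `c ≤ |g₀'(x)|` on a far half-line, and the bound `|ψ'(s) s^{k+1}/ψ(s)| < c`
  have hder0 : derivative g₀ ≠ 0 := by
    intro h
    rw [Polynomial.derivative_eq_zero] at h
    omega
  obtain ⟨c, R₁, hc, hcle⟩ := exists_pos_le_norm_eval (derivative g₀) hder0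
  set G : ℂ → ℂ := fun s => deriv ψ s * s ^ (k + 1) / ψ s with hG
  have hGlim : Tendsto G (𝓝 0) (𝓝 0) := by
    have hcont : ContinuousAt G 0 :=
      ((hψ.deriv.continuousAt.mul (continuousAt_id.pow (k + 1))).div hψ.continuousAt
        (by rw [hψ0]; exact hθ0))
    have h := hcont.tendsto
    simp only [hG, zero_pow (Nat.succ_ne_zero k), mul_zero, zero_div] at h
    exact h
  have hGsmall : ∀ᶠ s in 𝓝 (0 : ℂ), ‖G s‖ < c := by
    have := hGlim.eventually (Metric.ball_mem_nhds (0 : ℂ) hc)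
    filter_upwards [this] with s hs
    rw [dist_zero_right] at hs
    exact hs
  -- all `s`-side facts on a punctured disc
  have hmne : ∀ᶠ s in 𝓝[≠] (0 : ℂ), m s ≠ 0 := by
    refine eventually_nhdsWithin_iff.2 ?_
    filter_upwards [hchart] with s hs hs0 using (hs.2.2.2.2 hs0).1
  have hmtend : Tendsto m (𝓝[≠] (0 : ℂ)) (𝓝[≠] 0) := by
    refine tendsto_nhdsWithin_iff.2 ⟨?_, hmne⟩
    have h := hman.continuousAt.tendsto
    rw [hm0] at h
    exact h.mono_left nhdsWithin_le_nhds
  have hfacts : ∀ᶠ s in 𝓝[≠] (0 : ℂ), AnalyticAt ℂ ψ s ∧ ψ s ≠ 0 ∧ ψ s / θ ∈ Complex.slitPlane ∧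
      AnalyticAt ℂ m s ∧ m s ≠ 0 ∧
      (2 * Real.pi * I) * (m s ^ K)⁻¹ = g₀.eval (s ^ k)⁻¹ - Complex.log (ψ s / θ) - τ ∧
      (Q.map (Polynomial.evalRingHom (s ^ k)⁻¹)).eval (ψ s) = 0 ∧
      (H.map (Polynomial.evalRingHom (g₀.eval (s ^ k)⁻¹))).eval
        (Complex.exp (g₁.eval (s ^ k)⁻¹ - Pl.eval (m s)⁻¹)) = 0 ∧ ‖G s‖ < c := by
    filter_upwards [nhdsWithin_le_nhds hchart, nhdsWithin_le_nhds hman.eventually_analyticAt,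
      hbranch, hside, hmtend.eventually hH, nhdsWithin_le_nhds hGsmall, self_mem_nhdsWithin]
      with s hch hma hb hsd hHs hGs hs0
    obtain ⟨hψan, hψne, hslit, -, hc'⟩ := hch
    obtain ⟨hms, hid⟩ := hc' hs0
    obtain ⟨hU', hr'⟩ := hsd
    rw [hU', hr'] at hHs
    exact ⟨hψan, hψne, hslit, hma, hms, hid, hb, hHs, hGs⟩
  obtain ⟨δ, hδ, hball⟩ := Metric.eventually_nhds_iff.1 (eventually_nhdsWithin_iff.1 hfacts)
  -- the `z`-side: `s = sroot z = exp(-(1/k) log z)` near a large real point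
  set sroot : ℂ → ℂ := fun z => Complex.exp (-(1 / (k : ℂ)) * Complex.log z) with hsroot
  have hsroot_pow : ∀ z : ℂ, z ≠ 0 → sroot z ^ k = z⁻¹ := by
    intro z hz
    rw [hsroot, ← Complex.exp_nat_mul, ← mul_assoc, show ((k : ℂ)) * -(1 / (k : ℂ)) = -1 by
      field_simp, neg_one_mul, Complex.exp_neg, Complex.exp_log hz]
  have hsroot_ne : ∀ z, sroot z ≠ 0 := fun z => Complex.exp_ne_zero _
  have hsroot_an : ∀ z : ℂ, z ∈ Complex.slitPlane → AnalyticAt ℂ sroot z := fun z hz =>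
    (analyticAt_const.mul (analyticAt_clog hz)).cexp
  have hsroot_deriv : ∀ z : ℂ, z ∈ Complex.slitPlane →
      HasDerivAt sroot (sroot z * (-(1 / (k : ℂ)) * z⁻¹)) z := fun z hz =>
    ((Complex.hasDerivAt_log hz).const_mul (-(1 / (k : ℂ)))).cexp
  have hsroot_small : ∀ z : ℂ, δ⁻¹ ^ k < ‖z‖ → ‖sroot z‖ < δ := by
    intro z hz
    have hzpos : 0 < ‖z‖ := lt_of_le_of_lt (by positivity) hz
    have hz0 : z ≠ 0 := norm_pos_iff.1 hzpos
    refine lt_of_pow_lt_pow_left₀ k hδ.le ?_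
    rw [← norm_pow, hsroot_pow z hz0, norm_inv]
    calc ‖z‖⁻¹ < (δ⁻¹ ^ k)⁻¹ := (inv_lt_inv₀ hzpos (by positivity)).2 hz
      _ = δ ^ k := by rw [inv_pow, inv_inv]
  set z₀r : ℝ := max (δ⁻¹ ^ k + 1) R₁ with hz₀r
  have hz₀r_pos : 0 < z₀r := lt_of_lt_of_le (by positivity) (le_max_left _ _)
  set z₀ : ℂ := (z₀r : ℂ) with hz₀def
  have hz₀norm : δ⁻¹ ^ k < ‖z₀‖ := by
    rw [hz₀def, Complex.norm_real, Real.norm_eq_abs, abs_of_pos hz₀r_pos]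
    exact lt_of_lt_of_le (by linarith) (le_max_left _ _)
  have hz₀slit : z₀ ∈ Complex.slitPlane := by
    rw [hz₀def, Complex.ofReal_mem_slitPlane]; exact hz₀r_pos
  have hz₀R₁ : c ≤ ‖(derivative g₀).eval z₀‖ := hcle z₀r (le_max_right _ _)
  have hnear : ∀ᶠ y in 𝓝 z₀, δ⁻¹ ^ k < ‖y‖ ∧ y ∈ Complex.slitPlane :=
    ((continuous_norm.continuousAt (x := z₀)).eventually (lt_mem_nhds hz₀norm)).and
      (Complex.isOpen_slitPlane.mem_nhds hz₀slit)
  -- the facts at every good `z`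
  have hgoodz : ∀ y : ℂ, δ⁻¹ ^ k < ‖y‖ → y ∈ Complex.slitPlane →
      y ≠ 0 ∧ AnalyticAt ℂ sroot y ∧ (sroot y ^ k)⁻¹ = y ∧
      AnalyticAt ℂ ψ (sroot y) ∧ ψ (sroot y) ≠ 0 ∧ ψ (sroot y) / θ ∈ Complex.slitPlane ∧
      AnalyticAt ℂ m (sroot y) ∧ m (sroot y) ≠ 0 ∧
      (2 * Real.pi * I) * (m (sroot y) ^ K)⁻¹ = g₀.eval y - Complex.log (ψ (sroot y) / θ) - τ ∧
      (Q.map (Polynomial.evalRingHom y)).eval (ψ (sroot y)) = 0 ∧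
      (H.map (Polynomial.evalRingHom (g₀.eval y))).eval
        (Complex.exp (g₁.eval y - Pl.eval (m (sroot y))⁻¹)) = 0 ∧ ‖G (sroot y)‖ < c := by
    intro y hy hslit
    have hypos : 0 < ‖y‖ := lt_of_le_of_lt (by positivity) hy
    have hy0 : y ≠ 0 := norm_pos_iff.1 hypos
    have hinv : (sroot y ^ k)⁻¹ = y := by rw [hsroot_pow y hy0, inv_inv]
    obtain ⟨h1, h2, h3, h4, h5, h6, h7, h8, h9⟩ :=
      hball (by rw [dist_zero_right]; exact hsroot_small y hy) (hsroot_ne y)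
    rw [hinv] at h6 h7 h8
    exact ⟨hy0, hsroot_an y hslit, hinv, h1, h2, h3, h4, h5, h6, h7, h8, h9⟩
  obtain ⟨hz₀0, hsan₀, hinv₀, hψan₀, hψne₀, hslit₀, hman₀, hmne₀, -, -, -, hG₀⟩ :=
    hgoodz z₀ hz₀norm hz₀slit
  -- the branch `ρ = ψ ∘ sroot`, its logarithm, its logarithmic derivative, and `R = 1/(m ∘ sroot)`
  set ρ : ℂ → ℂ := fun y => ψ (sroot y) with hρ
  set L : ℂ → ℂ := fun y => Complex.log (ρ y / θ) with hL
  set g : ℂ → ℂ := fun y => deriv ρ y / ρ y with hg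
  set Rf : ℂ → ℂ := fun y => (m (sroot y))⁻¹ with hRf
  have hρan : ∀ y : ℂ, δ⁻¹ ^ k < ‖y‖ → y ∈ Complex.slitPlane → AnalyticAt ℂ ρ y := fun y hy hs =>
    (hgoodz y hy hs).2.2.2.1.comp (hgoodz y hy hs).2.1
  have hρan₀ : AnalyticAt ℂ ρ z₀ := hρan z₀ hz₀norm hz₀slit
  have hρ0 : ρ z₀ ≠ 0 := hψne₀
  have hLan : AnalyticAt ℂ L z₀ := hρan₀.div_const.clog hslit₀
  have hgan : AnalyticAt ℂ g z₀ := hρan₀.deriv.div hρan₀ hρ0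
  have hRan : AnalyticAt ℂ Rf z₀ := (hman₀.comp hsan₀).inv hmne₀
  have hρderiv : ∀ᶠ y in 𝓝 z₀, HasDerivAt ρ (ρ y * g y) y := by
    filter_upwards [hnear] with y hy
    have h := (hρan y hy.1 hy.2).differentiableAt.hasDerivAt
    refine h.congr_deriv ?_
    rw [hg]
    simp only
    rw [mul_div_cancel₀ _ (hgoodz y hy.1 hy.2).2.2.2.2.1]
  have hLderiv : ∀ᶠ y in 𝓝 z₀, HasDerivAt L (g y) y := by
    filter_upwards [hnear] with y hy
    obtain ⟨-, -, -, -, hne, hslit, -⟩ := hgoodz y hy.1 hy.2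
    have h := ((hρan y hy.1 hy.2).differentiableAt.hasDerivAt.div_const θ).clog hslit
    refine h.congr_deriv ?_
    rw [hg]
    change deriv ρ y / θ / (ρ y / θ) = deriv ρ y / ρ y
    field_simp
  have hQρ : ∀ᶠ y in 𝓝 z₀, (Q.map (Polynomial.evalRingHom y)).eval (ρ y) = 0 := by
    filter_upwards [hnear] with y hy using (hgoodz y hy.1 hy.2).2.2.2.2.2.2.2.2.2.1
  -- `g` is algebraic (irreducibility) and `g(z₀) ≠ g₀'(z₀)` (`|g(z₀)| = |G(s₀)|/k < c ≤ |g₀'(z₀)|`)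
  have hgalg := isAlgebraic_logDeriv_of_irreducible hρan₀ hgan hρderiv hQirr hQ1 hρ0 hQρ
  have hg1 : g z₀ ≠ (derivative g₀).eval z₀ := by
    have hderiv : deriv ρ z₀ = deriv ψ (sroot z₀) * (sroot z₀ * (-(1 / (k : ℂ)) * z₀⁻¹)) :=
      ((hψan₀.differentiableAt.hasDerivAt).comp z₀ (hsroot_deriv z₀ hz₀slit)).deriv
    have hval : g z₀ = -(1 / (k : ℂ)) * G (sroot z₀) := by
      rw [hg, hG]
      simp only [hρ]
      rw [hderiv, ← hsroot_pow z₀ hz₀0, pow_succ]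
      field_simp
    intro h1
    rw [hval] at h1
    have hn := congrArg (fun x : ℂ => ‖x‖) h1
    simp only [norm_mul, norm_neg, norm_div, norm_one, Complex.norm_natCast] at hn
    have hk1 : (1 : ℝ) ≤ k := by exact_mod_cast hk
    have : 1 / (k : ℝ) * ‖G (sroot z₀)‖ < c := by
      calc 1 / (k : ℝ) * ‖G (sroot z₀)‖ ≤ 1 * ‖G (sroot z₀)‖ := by
            refine mul_le_mul_of_nonneg_right ?_ (norm_nonneg _)
            rw [div_le_one (by positivity)]; exact hk1
        _ < c := by rw [one_mul]; exact hG₀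
    linarith
  -- the chart identity and the relation on the `z`-side
  have hR : ∀ᶠ y in 𝓝 z₀, (2 * Real.pi * I) * Rf y ^ K = g₀.eval y - L y - τ := by
    filter_upwards [hnear] with y hy
    obtain ⟨-, -, -, -, -, -, -, -, hid, -⟩ := hgoodz y hy.1 hy.2
    rw [hRf, hL]
    simp only [hρ]
    rw [inv_pow]
    exact hid
  set Hc : ℂ[X][X] := H.map (Polynomial.compRingHom g₀) with hHc
  have hHc0 : Hc ≠ 0 := map_compRingHom_ne_zero hH0 hd
  have hHw : ∀ᶠ y in 𝓝 z₀, (Hc.map (Polynomial.evalRingHom y)).eval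
      (Complex.exp (g₁.eval y - Pl.eval (Rf y))) = 0 := by
    filter_upwards [hnear] with y hy
    rw [hHc, map_evalRingHom_map_compRingHom]
    exact (hgoodz y hy.1 hy.2).2.2.2.2.2.2.2.2.2.2.1
  have hPt : K + 1 ≤ Pl.natDegree := by
    rw [hPl, hKdef]
    have h1 : k * d + k ≤ k * g₁.natDegree := by
      rw [← Nat.mul_succ]
      exact Nat.mul_le_mul_left k hlt
    omega
  refine ⟨z₀, ρ, L, hLan, hρan₀, hρ0, hQρ, hLderiv, ?_⟩
  exact isAlgebraic_log_of_paramExp_relation_ramified hLan hgan hLderiv hgalg g₀ hg1 hRan hK hR g₁ Pl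
    hPt hHc0 hHw

end Summit.Schanuel.Schanuel.Theorems
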